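import Summits.QuantumFields.YangMills.Theorems.TubeZeroFreeChannel.Negative.KillCriteria
import Summits.QuantumFields.YangMills.Theorems.ComplexCouplingChannelTubeZeroFreeChannelStubVesRep
import Summits.QuantumFields.YangMills.Theorems.ComplexCouplingChannelTubeZeroFreeChannelStubTubeRate
import Summits.QuantumFields.YangMills.Theorems.ComplexCouplingChannelTubeZeroFreeChannelStubTubeRateLimit
import Literature.MathematicalPhysics.QuantumLattice.GaugeGroupsProofs
import Literature.MathematicalPhysics.QuantumLattice.LatticeGaugeDLR
import Literature.MathematicalPhysics.QuantumLattice.NonlinearPlaquetteActionFirstOrder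
import Literature.Analysis.Complex.EquimodularZeroAccumulation

/-!
# Line `legendre-capped-pocket` — stub-form skeleton (crux `TubeZeroFreeChannel`, stmt-QuantumFields-18841)

LEAD RESHAPE (prover-line-stmt-QuantumFields-18841-a2-0, 2026-08-17, cycle 1): the planner's monolithic print stub
`stub_vesFirstOrderWall` (W, XL) is split BY CONTENT into three registered stubs over tree declarations —
`stub_tubeRate` (W1: the `t → ∞` tube rate at real coupling `x ≥ 0` exists and is `log λ₊(x, L)/L³`, the transfer
matrix's principal growth rate `transferSpectralRadius`; provable now from `exists_spectralData_wilsonFinTorusPartition`),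
`stub_tubeRateLimit` (W2: the tube rates converge to the torus free energy density `freeEnergyDensity 4 r.ρ x` of
`LatticeGaugeDLR`; classical thermodynamic limit, provable from the tree's `FreeEnergy` machinery) and
`stub_vesFreeEnergyNotDifferentiable` (W3: van Enter–Shlosman's Theorem 2 in tree currency — the torus free energy
density of `(SU(2), r_p)`, `p ≥ p₀`, is not differentiable at some `x₁ > 0`; print, XL) — and W is now the THEOREM
`vesFirstOrderWall_of_stubs` (W1 ∧ W2 ∧ W3 ⇒ W).  Stubs R and P are untouched; the composition is unchanged.

Planner: planner-cruxplan-stmt-QuantumFields-18841-legendre-capped-pock-0 (2026-08-17), from the crux idea card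
`Cruxes/TubeZeroFreeChannel/Ideas/legendre-capped-pocket.md` (negation lens; triage r1: pass ×2, sharpening
"curved wall profile" applied).  This is a REFUTATION line: its composition `TubeZeroFreeChannel_refuted_of`
concludes `¬ TubeZeroFreeChannel` BY NAME (registration handle `NotTubeZeroFreeChannel`, `Iff.rfl` with the
negated route decl), modulo exactly the five `stub_*` theorems below — the only `sorry`s of the file.

Mechanism.  Instantiate the crux's `∀ G, ∀ r` at `G = SU(2)` and the van Enter–Shlosman representations
`r_p = (4·𝟙 ⊕ V ⊕ V̄)^{⊗p}`, whose Wilson action `r.N − Re tr r(U) = 8^p (1 − ((1 + Re tr U/2)/2)^p)` is the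
nonlinear gauge action of van Enter–Shlosman (CMP 255 (2005) 21, Thm 2: first-order bulk transition at a real
`x₁ = z_t(p) > 0` for `p ≥ p₀`).  The card's thesis (Legendre cartography): a temperature-driven first-order
wall has only REAL spinodal branch points, so the complex coexistence wall `Re f_o = Re f_d` rising from `z_t`
has no door below the asymptotic-freedom CAP (vacuum/torelon equimodularity, height `≈ 11N²/(48π)` in
`β_eff` units, present for every cross-section `L`); wall-below-cap ∪ cap bound a CAPPED POCKET
`{w(Im z) < Re z, |Im z| < h(Re z)}` (curved wall profile `w`, `w 0 = z_t`; cap height `h > 0`) around every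
large real coupling, every frontier point of which is a cofinal accumulation point of tube zeros — a sealed
wall, which refutes the crux by the LANDED kill criterion
`Negative.not_tubeZeroFreeChannel_of_sealedWall` (p149201).

Stubs (to be registered with `ledger skeleton check … --crux-decl …LegendreCappedPocket.NotTubeZeroFreeChannel`):
* `stub_vesRep` (R, construction, size M, landable now): for every `p ≥ 1` a faithful continuous unitary
  `r : LatticeRep SU(2)` with the vES action.
* W = `vesFirstOrderWall_of_stubs` (THEOREM from the three stubs W1 `stub_tubeRate` (M, provable now), W2
  `stub_tubeRateLimit` (M/L, classical) and W3 `stub_vesFreeEnergyNotDifferentiable` (XL, print: vES Thm 2)):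
  tube rates `e L x`, bulk free energy `f`, `f` NOT differentiable at some `x₁ > 0` — this is `Disproof.lean`
  NEAR-MISS 1 `exists_wall_vES` with the stronger (first-order) conclusion.
* `stub_cappedPocket_of_firstOrderWall` (P, the physics; hardest; open-problem grade): at `(SU(2), r_p)`,
  `p ≥ p₀`, a first-order wall at `x₁ > 0` spawns a curved capped pocket whose wall segment below the cap and
  whose cap to the right of the wall consist of accumulation points.
Everything else is proved: the curved-pocket topology (`isOpen_pocket`, `frontier_pocket_subset`,
`ofReal_mem_pocket`, `ofReal_not_mem_closure_pocket`), the glue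
`not_tubeZeroFreeChannel_of_curvedCappedPocket`, SU(2) admissibility, the composition, and two TOOLS for the
prover of stub P: `acc_of_tendsto` (the accumulation set is closed: triple point and wall foot come for free)
and `acc_of_cofinal_twoBranchTies` (Beraha–Kahane–Weiss conversion: cofinally-in-`L` two-dominant-branch ties
near `z₀` ⇒ accumulation at `z₀`, from the landed `Literature.Analysis.Complex.exists_zero_near_equimodular_point`).

Why the cap is not a separate stub: as a TOP tie (hence a zero locus) the vacuum/torelon equimodularity curve
exists only to the right of the coexistence wall, i.e. from the triple point `x_T = w(h x_T)` on — a junction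
datum of BOTH curves; two independent existential stubs (wall, cap) cannot be made compatible without
hand-picked height/abscissa constants (crux typing checklist 4c(iv)).  Stub P therefore delivers `w` and `h`
jointly and asks for accumulation EXACTLY on `{Re z = w(Im z), |Im z| ≤ h(Re z)} ∪ {|Im z| = h(Re z), w(Im z) ≤ Re z}`
(a superset of the pocket's frontier, `frontier_pocket_subset`), nothing more.
-/

set_option autoImplicit false

noncomputable section

namespace Summit.QuantumFields.YangMills.Cruxes.TubeZeroFreeChannel.LegendreCappedPocket

open scoped Topology
open Filter Set Metric MeasureTheory
open Literature.MathematicalPhysics.QuantumFieldTheory (LatticeRep IsCompactSimpleLieGroup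
  isCompactSimpleLieGroup_specialUnitaryGroup transferSpectralRadius)
open Literature.MathematicalPhysics.QuantumLattice (isSimpleCompactGroup_specialUnitaryGroup_holds
  freeEnergyDensity vanEnterShlosman_firstOrder)
open Summit.QuantumFields.YangMills.Theses.ComplexCouplingChannel (TubeZeroFreeChannel)
open Summit.QuantumFields.YangMills.Theorems.TubeZeroFreeChannel.Negative
  (boxZ not_tubeZeroFreeChannel_of_sealedWall tubeZeroFreeChannel_iff_boxZ)

/-! ## The five stubs (R; W1, W2, W3 replacing the planner's W; P) -/

/-- STUB R `stub_vesRep` — LANDED (p157078, `Theorems/ComplexCouplingChannelTubeZeroFreeChannelStubVesRep.lean`,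
worker of lead a2).  (construction; size M).  For every `p ≥ 1` there is a faithful
continuous unitary lattice representation `r` of `SU(2)` whose Wilson action is the van Enter–Shlosman
nonlinear action: `r.N − Re tr r(U) = 8^p · (1 − ((1 + Re tr U / 2)/2)^p)`.  Intended witness:
`r_p = (4·𝟙 ⊕ V ⊕ V̄)^{⊗p}` (`V` the fundamental representation; `N = 8^p`,
`tr r_p(U) = (4 + 2 Re tr U)^p`; faithful because `4·𝟙 ⊕ U ⊕ Ū` has the eigenvalue `1`, so a scalar Kronecker
power forces `U = 1`; unitary and continuous as a Kronecker power of unitaries).  Bookkeeping-mathematics: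
Kronecker powers `Matrix.kroneckerMap` reindexed to `Fin (8^p)`, `Matrix.unitaryGroup` closure under `⊗ₖ`,
`Matrix.trace_kronecker`. -/
theorem stub_vesRep :
    ∀ p : ℕ, 1 ≤ p → ∃ r : LatticeRep (Matrix.specialUnitaryGroup (Fin 2) ℂ),
      ∀ U : Matrix.specialUnitaryGroup (Fin 2) ℂ,
        (r.N : ℝ) - (r.ρ U).trace.re =
          (8 : ℝ) ^ p * (1 - ((1 + (U : Matrix (Fin 2) (Fin 2) ℂ).trace.re / 2) / 2) ^ p) :=
  Summit.QuantumFields.YangMills.Theorems.TubeZeroFreeChannel.stub_vesRep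

/-- STUB W1 `stub_tubeRate` — LANDED (p156597, `Theorems/ComplexCouplingChannelTubeZeroFreeChannelStubTubeRate.lean`,
worker of lead a2).  (real-coupling transfer-matrix bookkeeping; size M).  For every
admissible `(G, r)`, every real coupling `x ≥ 0` and every cross-section `L ≥ 1`, the TUBE RATE exists:
`(L³ t)⁻¹ log Z(x; L, t) → log λ₊(x, L) / L³` as `t → ∞`, where `λ₊ = transferSpectralRadius r.ρ x L > 0` is the
principal growth rate (top eigenvalue = operator norm) of Lüscher's transfer matrix on the spatial torus `(ℤ/L)³`.
Route: `boxZ r x L t = wilsonFinTorusPartition r.ρ x L L L t` (`Iff.rfl` chain: `wilsonFinTorusPartitionC_eq_inline`,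
`wilsonFinTorusPartitionC_ofReal`), the trace formula `Z(L³ × (m+2)) = Σᵢ λᵢ^{m+2}` with `0 ≤ λᵢ ≤ λ_{i₀} = λ₊`,
`0 < λ₊`, `Σ λᵢ² < ∞` (`exists_spectralData_wilsonFinTorusPartition`, second countability of `G` from the faithful
`r` as in `LatticeRep.curvature`), hence `λ₊^t ≤ Z ≤ λ₊^{t−2} Σᵢ λᵢ²` for `t ≥ 2` and `t⁻¹ log Z → log λ₊`. -/
theorem stub_tubeRate {G : Type} [Group G] [TopologicalSpace G] [IsTopologicalGroup G] [CompactSpace G]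
    [MeasurableSpace G] [BorelSpace G] (r : LatticeRep G) (x : ℝ) (hx : 0 ≤ x) (L : ℕ) [NeZero L] :
    Tendsto (fun t : ℕ => Real.log ‖boxZ r (x : ℂ) L t‖ / ((L : ℝ) ^ 3 * t)) atTop
      (𝓝 (Real.log (transferSpectralRadius r.ρ x L) / (L : ℝ) ^ 3)) :=
  Summit.QuantumFields.YangMills.Theorems.TubeZeroFreeChannel.stub_tubeRate r x hx L

/-- STUB W2 `stub_tubeRateLimit` — LANDED (p156850,
`Theorems/ComplexCouplingChannelTubeZeroFreeChannelStubTubeRateLimit.lean`, worker of lead a2).  (classical; size M).  For every admissible `(G, r)` and real `x ≥ 0` the tube rates converge, as the cross-section `L → ∞`, to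
the TORUS free energy density `f(x) = lim_P P⁻⁴ log Z(x; P⁴)` of `LatticeGaugeDLR` (`freeEnergyDensity 4 r.ρ x`, which
EXISTS: `exists_hasFreeEnergyDensity_holds`).  Route (everything in the tree, no tiling): read the SYMMETRIC torus `P⁴` as a
tube of cross-section `P` and length `P` — by the trace formula at `L := P`, `m := P − 2`
(`exists_spectralData_wilsonFinTorusPartition`), `Z(x; P⁴) = Σᵢ λᵢ(P)^P` with `0 ≤ λᵢ ≤ λ₊ = transferSpectralRadius r.ρ x P`,
so `λ₊^P ≤ Z(x; P⁴) ≤ λ₊^{P−2} · Z(x; P³ × 2)`; the volume bounds `Z(x; P³ × 2) ≤ e^{12 |x| c P³}` (`norm_boxZ_le`) and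
`λ₊ ≥ Z(x; P³ × 3)/Z(x; P³ × 2) ≥ e^{−30 |x| c P³}` (`boxZ_ofReal`) give `|P⁻⁴ log Z(x; P⁴) − P⁻³ log λ₊(P)| ≤ C_x / P → 0`,
while `P⁻⁴ log Z(x; P⁴) → freeEnergyDensity 4 r.ρ x` IS `HasFreeEnergyDensity` (dictionary
`toReal_partitionFunction_eq_wilsonFinTorusPartition`, `torusLogPartition`). -/
theorem stub_tubeRateLimit {G : Type} [Group G] [TopologicalSpace G] [IsTopologicalGroup G] [CompactSpace G]
    [MeasurableSpace G] [BorelSpace G] (r : LatticeRep G) (x : ℝ) (hx : 0 ≤ x) :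
    Tendsto (fun L : ℕ => Real.log (transferSpectralRadius r.ρ x (L + 1)) / ((L + 1 : ℕ) : ℝ) ^ 3) atTop
      (𝓝 (freeEnergyDensity 4 r.ρ x)) :=
  Summit.QuantumFields.YangMills.Theorems.TubeZeroFreeChannel.stub_tubeRateLimit r x hx

/-- STUB W3 `stub_vesFreeEnergyNotDifferentiable` = the Literature NAMED FACT
`Literature.MathematicalPhysics.QuantumLattice.vanEnterShlosman_firstOrder` VERBATIM (filed by lead a2, p157326 ACCEPTED,
`Literature/MathematicalPhysics/QuantumLattice/NonlinearPlaquetteActionFirstOrder.lean`; unproved: discharging it —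
`theorem vanEnterShlosman_firstOrder_holds` — closes this stub by `:= vanEnterShlosman_firstOrder_holds`).  (A theorem IN
PRINT; size XL: reflection positivity + chessboard estimates + contour counting for the nonlinear plaquette action.)  van Enter–Shlosman, Commun. Math. Phys. 255 (2005)
21–32 = arXiv:cond-mat/0306362, Theorem 2 (p. 3, read: "For lattice gauge models with plaquette action
((1 + L(U_P))/2)^p … in dimension 3 and more and p high enough, there is a first order transition, that is there exists
a temperature at which the free energy is not differentiable in the temperature parameter"; normalised reading
`L(U) = Re tr U / N`), in tree currency: for `p ≥ p₀` and ANY `r : LatticeRep SU(2)` with the vES action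
`r.N − Re tr r(U) = 8^p (1 − ((1 + Re tr U/2)/2)^p)` — so that the Wilson weight of `r` at coupling `x` is vES's weight
at `J = 8^p x` times the smooth factor `e^{−6·8^p x}` per site — the torus free energy density
`x ↦ freeEnergyDensity 4 r.ρ x` is NOT differentiable at some `x₁ > 0` (`x₁ = J_t(p)/8^p`).  With W1, W2 this is
`Disproof.lean` §5 NEAR-MISS 1 (`exists_wall_vES`) with vES's actual (first-order) conclusion. -/
theorem stub_vesFreeEnergyNotDifferentiable : vanEnterShlosman_firstOrder := by
  sorry

/-- W3 in the line's currency (instantiate the named fact at `N := r.N`, `ρ := r.ρ`, `r.continuous`). -/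
theorem vesFreeEnergyNotDifferentiable_of_stub :
    ∃ p₀ : ℕ, ∀ p : ℕ, p₀ ≤ p → ∀ r : LatticeRep (Matrix.specialUnitaryGroup (Fin 2) ℂ),
      (∀ U : Matrix.specialUnitaryGroup (Fin 2) ℂ,
        (r.N : ℝ) - (r.ρ U).trace.re =
          (8 : ℝ) ^ p * (1 - ((1 + (U : Matrix (Fin 2) (Fin 2) ℂ).trace.re / 2) / 2) ^ p)) →
      ∃ x₁ : ℝ, 0 < x₁ ∧ ¬ DifferentiableAt ℝ (fun x : ℝ => freeEnergyDensity 4 r.ρ x) x₁ := by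
  obtain ⟨p₀, hp₀⟩ := stub_vesFreeEnergyNotDifferentiable
  exact ⟨p₀, fun p hp r hr => hp₀ p hp r.N r.ρ r.continuous hr⟩

/-- The tube rate of `(G, r)` at real coupling `x` and cross-section `L` (junk `0` at `L = 0`):
`e L x = log λ₊(x, L) / L³`. -/
def tubeRate {G : Type} [Group G] [TopologicalSpace G] [IsTopologicalGroup G] [CompactSpace G]
    [MeasurableSpace G] [BorelSpace G] (r : LatticeRep G) (L : ℕ) (x : ℝ) : ℝ :=
  if h : L = 0 then 0 else
    haveI : NeZero L := ⟨h⟩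
    Real.log (transferSpectralRadius r.ρ x L) / (L : ℝ) ^ 3

/-- W (the planner's `stub_vesFirstOrderWall`, now a THEOREM from W1, W2, W3): for `p ≥ p₀` and every
`r : LatticeRep SU(2)` with the vES action there are `x₁ > 0`, `R₀ > 0`, tube rates `e L x` (all `L ≥ 1`,
`|x − x₁| < R₀`) and a bulk free energy `f = lim_L e L` on `|x − x₁| < R₀` with `f` NOT differentiable at `x₁`.
Take `x₁` from W3, `R₀ := x₁` (so `|x − x₁| < R₀ ⇒ 0 < x`), `e := tubeRate r` (W1), `f := freeEnergyDensity 4 r.ρ` (W2). -/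
theorem vesFirstOrderWall_of_stubs :
    ∃ p₀ : ℕ, ∀ p : ℕ, p₀ ≤ p → ∀ r : LatticeRep (Matrix.specialUnitaryGroup (Fin 2) ℂ),
      (∀ U : Matrix.specialUnitaryGroup (Fin 2) ℂ,
        (r.N : ℝ) - (r.ρ U).trace.re =
          (8 : ℝ) ^ p * (1 - ((1 + (U : Matrix (Fin 2) (Fin 2) ℂ).trace.re / 2) / 2) ^ p)) →
      ∃ x₁ : ℝ, 0 < x₁ ∧ ∃ R₀ : ℝ, 0 < R₀ ∧ ∃ (e : ℕ → ℝ → ℝ) (f : ℝ → ℝ),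
        (∃ L₁ : ℕ, ∀ L : ℕ, L₁ ≤ L → ∀ x : ℝ, |x - x₁| < R₀ →
          Tendsto (fun t : ℕ => Real.log ‖boxZ r (x : ℂ) L t‖ / ((L : ℝ) ^ 3 * t)) atTop
            (𝓝 (e L x))) ∧
        (∀ x : ℝ, |x - x₁| < R₀ → Tendsto (fun L : ℕ => e L x) atTop (𝓝 (f x))) ∧
        ¬ DifferentiableAt ℝ f x₁ := by
  obtain ⟨p₀, hp₀⟩ := vesFreeEnergyNotDifferentiable_of_stub
  refine ⟨p₀, fun p hp r hr => ?_⟩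
  obtain ⟨x₁, hx₁, hnd⟩ := hp₀ p hp r hr
  have hpos : ∀ x : ℝ, |x - x₁| < x₁ → 0 ≤ x := fun x hx => by
    have := (abs_lt.mp hx).1; linarith
  refine ⟨x₁, hx₁, x₁, hx₁, tubeRate r, fun x => freeEnergyDensity 4 r.ρ x, ⟨1, fun L hL x hx => ?_⟩,
    fun x hx => ?_, hnd⟩
  · haveI : NeZero L := ⟨by omega⟩
    have h := stub_tubeRate r x (hpos x hx) L
    simpa only [tubeRate, NeZero.ne L, ↓reduceDIte] using h
  · have h := stub_tubeRateLimit r x (hpos x hx)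
    refine (tendsto_add_atTop_iff_nat (f := fun L : ℕ => tubeRate r L x) 1).1 (h.congr fun L => ?_)
    simp only [tubeRate, Nat.add_one_ne_zero, ↓reduceDIte]

/-- STUB P `stub_cappedPocket_of_firstOrderWall` (the physics; HARDEST; open-problem grade — needs two-sided
complex-coupling control of the weakly coupled ordered phase below the cap, census Fact B(iv), plus the
confinement-grade torelon cap).  At `(SU(2), r_p)`, `p ≥ p₀`: a first-order wall at a real `x₁ > 0` (tube rates
and bulk free energy exist near `x₁`, `f` not differentiable at `x₁`) spawns a CURVED CAPPED POCKET: continuous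
`w h : ℝ → ℝ` with `w 0 = x₁` (the coexistence wall `Re z = w(Im z)`, the level set `Re f_o = Re f_d` leaving the
axis at the transition point; triage r1 repair of the ideator's vertical edge) and `h > 0` (the cap
`|Im z| = h(Re z)`: vacuum/torelon equimodularity `Re σ(z) = 0`, height `≈ 0.584/(p·8^p)` in `z`-units, tending to
the asymptotic-freedom value as `Re z → ∞`), such that EVERY point of the wall segment below the cap
`{Re z = w(Im z), |Im z| ≤ h(Re z)}` and of the cap to the right of the wall `{|Im z| = h(Re z), w(Im z) ≤ Re z}` is
a cofinal (in `L`, then in `t`) accumulation point of zeros of the crux's box partition functions `boxZ r`.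
(Nothing is asked above the triple point on the wall or left of it on the cap; the accumulation set is closed,
`acc_of_tendsto`, so the triple point and the wall foot `x₁` follow from nearby points; the Beraha–Kahane–Weiss
conversion from cofinally-in-`L` two-dominant-branch ties to accumulation is `acc_of_cofinal_twoBranchTies`.)
Why no door (the card): in the pure Legendre slice `z ↦ z·S_W` the pure-phase free energies `f_o, f_d` have only
REAL spinodal branch points, so the harmonic function `Re(f_o − f_d)` has a door-free level curve through `z_t`
up to the next dominant tie — the cap, whose height `O(1/p)` in `ζ = 8^p z` units lies far below any `O(1)`
structure of the wall (toy checks kit j023307/j023327/j023371/j023409). -/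
theorem stub_cappedPocket_of_firstOrderWall :
    ∃ p₀ : ℕ, ∀ p : ℕ, p₀ ≤ p → ∀ r : LatticeRep (Matrix.specialUnitaryGroup (Fin 2) ℂ),
      (∀ U : Matrix.specialUnitaryGroup (Fin 2) ℂ,
        (r.N : ℝ) - (r.ρ U).trace.re =
          (8 : ℝ) ^ p * (1 - ((1 + (U : Matrix (Fin 2) (Fin 2) ℂ).trace.re / 2) / 2) ^ p)) →
      ∀ x₁ : ℝ, 0 < x₁ →
      (∃ R₀ : ℝ, 0 < R₀ ∧ ∃ (e : ℕ → ℝ → ℝ) (f : ℝ → ℝ),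
        (∃ L₁ : ℕ, ∀ L : ℕ, L₁ ≤ L → ∀ x : ℝ, |x - x₁| < R₀ →
          Tendsto (fun t : ℕ => Real.log ‖boxZ r (x : ℂ) L t‖ / ((L : ℝ) ^ 3 * t)) atTop
            (𝓝 (e L x))) ∧
        (∀ x : ℝ, |x - x₁| < R₀ → Tendsto (fun L : ℕ => e L x) atTop (𝓝 (f x))) ∧
        ¬ DifferentiableAt ℝ f x₁) →
      ∃ (w h : ℝ → ℝ), Continuous w ∧ Continuous h ∧ w 0 = x₁ ∧ (∀ x : ℝ, 0 < h x) ∧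
        ∀ z : ℂ, (z.re = w z.im ∧ |z.im| ≤ h z.re) ∨ (|z.im| = h z.re ∧ w z.im ≤ z.re) →
          ∀ ε : ℝ, 0 < ε → ∀ L₀ : ℕ, ∃ L : ℕ, L₀ ≤ L ∧ ∀ t₀ : ℕ, ∃ t : ℕ, t₀ ≤ t ∧
            ∃ u : ℂ, dist u z < ε ∧ boxZ r u L t = 0 := by
  sorry

/-! ## Accumulation points: definition (verbatim the frontier clause of `KillCriteria`) and two TOOLS -/

section Acc

variable {G : Type} [Group G] [TopologicalSpace G] [IsTopologicalGroup G] [CompactSpace G]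
  [MeasurableSpace G] [BorelSpace G]

/-- `z` is a COFINAL ACCUMULATION POINT of tube zeros of `(G, r)` (cofinal in `L`, then in `t`; verbatim the
frontier clause of `Negative.not_tubeZeroFreeChannel_of_sealedWall`). -/
def Acc (r : LatticeRep G) (z : ℂ) : Prop :=
  ∀ ε : ℝ, 0 < ε → ∀ L₀ : ℕ, ∃ L : ℕ, L₀ ≤ L ∧ ∀ t₀ : ℕ, ∃ t : ℕ, t₀ ≤ t ∧
    ∃ u : ℂ, dist u z < ε ∧ boxZ r u L t = 0

/-- TOOL 1: the accumulation set is CLOSED — a limit of accumulation points is an accumulation point (so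
stub P's prover gets the triple point and the wall foot `x₁` from nearby wall/cap points). -/
theorem acc_of_tendsto (r : LatticeRep G) {z : ℂ} {s : ℕ → ℂ} (hs : Tendsto s atTop (𝓝 z))
    (hacc : ∀ n, Acc r (s n)) : Acc r z := by
  intro ε hε L₀
  have hε2 : 0 < ε / 2 := by linarith
  obtain ⟨n, hn⟩ := (Metric.tendsto_atTop.1 hs (ε / 2) hε2)
  obtain ⟨L, hL, hLt⟩ := hacc n (ε / 2) hε2 L₀
  refine ⟨L, hL, fun t₀ => ?_⟩
  obtain ⟨t, ht, u, hu, hZ⟩ := hLt t₀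
  refine ⟨t, ht, u, ?_, hZ⟩
  calc dist u z ≤ dist u (s n) + dist (s n) z := dist_triangle _ _ _
    _ < ε / 2 + ε / 2 := add_lt_add hu (hn n le_rfl)
    _ = ε := by ring

/-- A point of the closure of the accumulation set is an accumulation point. -/
theorem acc_of_mem_closure (r : LatticeRep G) {z : ℂ} (hz : z ∈ closure {u : ℂ | Acc r u}) :
    Acc r z := by
  obtain ⟨s, hs, hlim⟩ := mem_closure_iff_seq_limit.1 hz
  exact acc_of_tendsto r hlim hs

/-- TOOL 2 (Beraha–Kahane–Weiss conversion, from the landed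
`Literature.Analysis.Complex.exists_zero_near_equimodular_point`): if, cofinally in the cross-section `L`,
arbitrarily close to `z₀` there is a point `z₁` at which — for that `L` and all large `t` — the box partition
functions `boxZ r · L t` are a two-dominant-branch exponential sum `a·l₀^t + b·l₁^t + R_t` on a ball about `z₁`
with a modulus tie `‖l₁ z₁‖ = ‖l₀ z₁‖` (holomorphic data, `l₀` zero-free, `a z₁ ≠ 0 ≠ b z₁`, `l₁` not a constant
multiple of `l₀`, `‖R_t‖ ≤ C θ^t ‖l₀‖^t`, `θ < 1`), then `z₀` is an accumulation point.  (This is how a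
transfer-operator / Pirogov–Sinai description of the wall `Re f_o = Re f_d` and of the cap `Re σ = 0`, cross-section
by cross-section, feeds stub P.) -/
theorem acc_of_cofinal_twoBranchTies (r : LatticeRep G) {z₀ : ℂ}
    (h : ∀ ε : ℝ, 0 < ε → ∀ L₀ : ℕ, ∃ L : ℕ, L₀ ≤ L ∧ ∃ z₁ : ℂ, dist z₁ z₀ < ε ∧
      ∃ (l₀ l₁ a b : ℂ → ℂ) (ρ θ C : ℝ) (R : ℕ → ℂ → ℂ) (t₁ : ℕ),
        0 < ρ ∧ 0 ≤ θ ∧ θ < 1 ∧ 0 ≤ C ∧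
        DifferentiableOn ℂ l₀ (ball z₁ ρ) ∧ DifferentiableOn ℂ l₁ (ball z₁ ρ) ∧
        DifferentiableOn ℂ a (ball z₁ ρ) ∧ DifferentiableOn ℂ b (ball z₁ ρ) ∧
        (∀ z ∈ ball z₁ ρ, l₀ z ≠ 0) ∧ ‖l₁ z₁‖ = ‖l₀ z₁‖ ∧ a z₁ ≠ 0 ∧ b z₁ ≠ 0 ∧
        (¬ ∃ c : ℂ, ∀ z ∈ ball z₁ ρ, l₁ z = c * l₀ z) ∧
        (∀ t : ℕ, DifferentiableOn ℂ (R t) (ball z₁ ρ)) ∧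
        (∀ (t : ℕ) (z : ℂ), z ∈ ball z₁ ρ → ‖R t z‖ ≤ C * θ ^ t * ‖l₀ z‖ ^ t) ∧
        (∀ t : ℕ, t₁ ≤ t → ∀ z ∈ ball z₁ ρ,
          boxZ r z L t = a z * l₀ z ^ t + b z * l₁ z ^ t + R t z)) :
    Acc r z₀ := by
  intro ε hε L₀
  have hε2 : 0 < ε / 2 := by linarith
  obtain ⟨L, hL, z₁, hz₁, l₀, l₁, a, b, ρ, θ, C, R, t₁, hρ, hθ₀, hθ₁, hC, hl₀, hl₁, ha, hb, hl₀ne,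
    heq, ha₀, hb₀, hnc, hR, hRle, hZ⟩ := h (ε / 2) hε2 L₀
  refine ⟨L, hL, fun t₀ => ?_⟩
  -- BKW at `z₁` with radius `min (ε/2) ρ`
  have hε' : 0 < min (ε / 2) ρ := lt_min hε2 hρ
  obtain ⟨t₂, ht₂⟩ := Literature.Analysis.Complex.exists_zero_near_equimodular_point l₀ l₁ a b z₁ ρ θ C
    hρ hθ₀ hθ₁ hC hl₀ hl₁ ha hb hl₀ne heq ha₀ hb₀ hnc R hR hRle (min (ε / 2) ρ) hε'
  refine ⟨max t₀ (max t₁ t₂), le_max_left _ _, ?_⟩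
  obtain ⟨z, hz, hzero⟩ := ht₂ (max t₀ (max t₁ t₂)) (le_trans (le_max_right _ _) (le_max_right _ _))
  have hzρ : z ∈ ball z₁ ρ := ball_subset_ball (min_le_right _ _) hz
  have hzε : dist z z₁ < ε / 2 := lt_of_lt_of_le (mem_ball.1 hz) (min_le_left _ _)
  refine ⟨z, ?_, ?_⟩
  · calc dist z z₀ ≤ dist z z₁ + dist z₁ z₀ := dist_triangle _ _ _
      _ < ε / 2 + ε / 2 := add_lt_add hzε hz₁
      _ = ε := by ring
  · rw [hZ _ (le_trans (le_max_left _ _) (le_max_right _ _)) z hzρ]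
    exact hzero

end Acc

/-! ## The curved capped pocket: topology (proved; triage r1 repair of the vertical edge) -/

section Pocket

/-- The curved capped pocket with wall profile `w` (a graph `Re z = w(Im z)` over the imaginary direction)
and cap `|Im z| = h(Re z)`. -/
def pocket (w h : ℝ → ℝ) : Set ℂ := {z : ℂ | w z.im < z.re ∧ |z.im| < h z.re}

variable {w h : ℝ → ℝ}

/-- The pocket is open (continuity of `w`, `h`). -/
theorem isOpen_pocket (hw : Continuous w) (hh : Continuous h) : IsOpen (pocket w h) :=
  (isOpen_lt (hw.comp Complex.continuous_im) Complex.continuous_re).inter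
    (isOpen_lt (continuous_abs.comp Complex.continuous_im) (hh.comp Complex.continuous_re))

/-- Its closure lies in the closed pocket. -/
theorem closure_pocket_subset (hw : Continuous w) (hh : Continuous h) :
    closure (pocket w h) ⊆ {z : ℂ | w z.im ≤ z.re ∧ |z.im| ≤ h z.re} :=
  closure_minimal (fun _ hz => ⟨le_of_lt hz.1, le_of_lt hz.2⟩)
    ((isClosed_le (hw.comp Complex.continuous_im) Complex.continuous_re).inter
      (isClosed_le (continuous_abs.comp Complex.continuous_im) (hh.comp Complex.continuous_re)))

/-- **Frontier of the curved capped pocket** ⊆ (wall segment below the cap) ∪ (cap to the right of the wall). -/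
theorem frontier_pocket_subset (hw : Continuous w) (hh : Continuous h) :
    frontier (pocket w h) ⊆
      {z : ℂ | (z.re = w z.im ∧ |z.im| ≤ h z.re) ∨ (|z.im| = h z.re ∧ w z.im ≤ z.re)} := by
  intro z hz
  rw [frontier, (isOpen_pocket hw hh).interior_eq] at hz
  obtain ⟨hzc, hzn⟩ := hz
  obtain ⟨h1, h2⟩ := closure_pocket_subset hw hh hzc
  by_cases hre : z.re = w z.im
  · exact Or.inl ⟨hre, h2⟩
  · have hlt : w z.im < z.re := lt_of_le_of_ne h1 (Ne.symm hre)
    have him : ¬ |z.im| < h z.re := fun h3 => hzn ⟨hlt, h3⟩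
    exact Or.inr ⟨le_antisymm h2 (not_lt.1 him), h1⟩

/-- Every real coupling beyond the wall foot lies in the pocket. -/
theorem ofReal_mem_pocket {x₁ : ℝ} (hw0 : w 0 = x₁) (hpos : ∀ x, 0 < h x) {β : ℝ} (hβ : x₁ < β) :
    (β : ℂ) ∈ pocket w h := by
  refine ⟨?_, ?_⟩
  · simp only [Complex.ofReal_im, Complex.ofReal_re, hw0]; exact hβ
  · simp only [Complex.ofReal_im, Complex.ofReal_re, abs_zero]; exact hpos β

/-- No real coupling left of the wall foot lies in the closure of the pocket. -/
theorem ofReal_not_mem_closure_pocket (hw : Continuous w) (hh : Continuous h) {x₁ : ℝ}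
    (hw0 : w 0 = x₁) {x : ℝ} (hx : |x| < x₁) : (x : ℂ) ∉ closure (pocket w h) := by
  intro hxc
  have h1 := (closure_pocket_subset hw hh hxc).1
  simp only [Complex.ofReal_im, Complex.ofReal_re, hw0] at h1
  linarith [(abs_lt.mp hx).2]

end Pocket

/-! ## Glue: a curved capped pocket at ONE admissible `(G, r)` refutes the crux (landed KillCriteria) -/

section Glue

variable {G : Type} [Group G] [TopologicalSpace G] [IsTopologicalGroup G] [CompactSpace G]
  [MeasurableSpace G] [BorelSpace G]

/-- **Curved capped pocket ⇒ ¬ crux.**  If at an admissible `(G, r)` there are continuous `w h` with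
`w 0 = x₁ > 0`, `h > 0`, and every point of the wall segment below the cap and of the cap right of the wall is a
cofinal accumulation point of tube zeros, then `TubeZeroFreeChannel` is false: the pocket is a sealed wall
(`R = pocket w h` is open, contains every real `β ≥ x₁ + 1`, its closure misses every real `|x| < x₁`, and its
frontier lies in wall ∪ cap), and `Negative.not_tubeZeroFreeChannel_of_sealedWall` applies. -/
theorem not_tubeZeroFreeChannel_of_curvedCappedPocket (hG : IsCompactSimpleLieGroup G) (r : LatticeRep G)
    {x₁ : ℝ} (hx₁ : 0 < x₁) {w h : ℝ → ℝ} (hw : Continuous w) (hh : Continuous h) (hw0 : w 0 = x₁)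
    (hpos : ∀ x : ℝ, 0 < h x)
    (hacc : ∀ z : ℂ, (z.re = w z.im ∧ |z.im| ≤ h z.re) ∨ (|z.im| = h z.re ∧ w z.im ≤ z.re) →
      Acc r z) :
    ¬ TubeZeroFreeChannel :=
  not_tubeZeroFreeChannel_of_sealedWall hG r (isOpen_pocket hw hh) (b := x₁ + 1)
    (fun β hβ => ofReal_mem_pocket hw0 hpos (by linarith)) hx₁
    (fun x hx => ofReal_not_mem_closure_pocket hw hh hw0 hx)
    (fun z hz => hacc z (frontier_pocket_subset hw hh hz))

end Glue

/-! ## SU(2) is admissible -/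

/-- `SU(2)` is a compact simple Lie group in the crux's sense (simplicity PROVED in
`GaugeGroupsProofs`; the fundamental representation is faithful unitary continuous). -/
theorem su2_admissible : IsCompactSimpleLieGroup (Matrix.specialUnitaryGroup (Fin 2) ℂ) :=
  isCompactSimpleLieGroup_specialUnitaryGroup isSimpleCompactGroup_specialUnitaryGroup_holds le_rfl

/-! ## COMPOSITION: the stubs refute the crux BY NAME -/

/-- COMPOSITION (line `legendre-capped-pocket`): `stub_vesRep` (R), W = `vesFirstOrderWall_of_stubs`
(from `stub_tubeRate`, `stub_tubeRateLimit`, `stub_vesFreeEnergyNotDifferentiable`) and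
`stub_cappedPocket_of_firstOrderWall` (P) give `¬ TubeZeroFreeChannel`.  Take `p ≥ max p₀(W) p₀(P)`, `p ≥ 1`;
R supplies `r = r_p`; W supplies the first-order wall at `x₁ > 0`; P supplies the curved capped pocket; the
pocket is a sealed wall at the admissible `(SU(2), r_p)`. -/
theorem TubeZeroFreeChannel_refuted_of : ¬ TubeZeroFreeChannel := by
  obtain ⟨p₂, hp₂⟩ := vesFirstOrderWall_of_stubs
  obtain ⟨p₃, hp₃⟩ := stub_cappedPocket_of_firstOrderWall
  obtain ⟨r, hr⟩ := stub_vesRep (max (max p₂ p₃) 1) (le_max_right _ _)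
  obtain ⟨x₁, hx₁, hwall⟩ :=
    hp₂ (max (max p₂ p₃) 1) (le_trans (le_max_left _ _) (le_max_left _ _)) r hr
  obtain ⟨w, h, hw, hh, hw0, hpos, hacc⟩ :=
    hp₃ (max (max p₂ p₃) 1) (le_trans (le_max_right _ _) (le_max_left _ _)) r hr x₁ hx₁ hwall
  exact not_tubeZeroFreeChannel_of_curvedCappedPocket su2_admissible r hx₁ hw hh hw0 hpos hacc

/-- `¬ TubeZeroFreeChannel` under a NAME — the registration handle of this refutation line
(`ledger skeleton check … --crux-decl <this>`; the handle is the negated crux by `Iff.rfl`). -/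
def NotTubeZeroFreeChannel : Prop := ¬ TubeZeroFreeChannel

/-- The handle IS the negated crux, definitionally. -/
theorem notTubeZeroFreeChannel_iff : NotTubeZeroFreeChannel ↔ ¬ TubeZeroFreeChannel := Iff.rfl

/-- COMPOSITION under the registration handle. -/
theorem NotTubeZeroFreeChannel_of : NotTubeZeroFreeChannel := TubeZeroFreeChannel_refuted_of

end Summit.QuantumFields.YangMills.Cruxes.TubeZeroFreeChannel.LegendreCappedPocket
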